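import Summits.QuantumFields.YangMills.Theorems.ColdStartUniversalityLatticeLangevinWeightedBlocks
import Summits.QuantumFields.YangMills.Theorems.ColdStartUniversalityLatticeLangevinSplice
import HarnessLib

/-!
# Route `ColdStartUniversality` (fixed-cut-off SZZ dynamics, sampler package): JOINT CLT ESTIMATE FOR INCREMENTS OF THE PARTIAL-SUM PROCESS
# OVER BLOCK-ALIGNED WINDOWS — `‖E exp(iθ T^(−1/2) Σᵢ cᵢ ∫_(Kᵢb, Kᵢ₊₁b] Ĝ(U_r)dr) − exp(−θ²σ² Σᵢ cᵢ²(Kᵢ₊₁−Kᵢ)/J /2)‖ ≤ Φ_θ + 2|θ|β_u/√T`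

Helper file (seat `ym-line-csu-p1`, g35; `--supports stmt-QuantumFields-24809`).  Second step of the finite-dimensional FUNCTIONAL central limit
theorem (next file).  For block boundaries `0 = K₀ ≤ K₁ ≤ ⋯ ≤ K_m ≤ J` (windows `(Kᵢb, Kᵢ₊₁b]` of the run `(0, T]`, `T = Jb`) and coefficients
with `Σᵢ|cᵢ| ≤ 1`, the block weights `w_k = cᵢ` on window `i` turn the weighted block martingale of file 102a into
`Σᵢ cᵢ (∫_(Kᵢb,Kᵢ₊₁b] Ĝ(U_r)dr + u(U_(Kᵢ₊₁b)) − u(U_(Kᵢb)))` with `Σ_k w_k² = Σᵢ cᵢ²(Kᵢ₊₁ − Kᵢ)`; the corrector terms cost `2β_u Σ|cᵢ|/√T`.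
Hence (★★ `norm_charFun_windowIncrements_sub_gaussian_le_of_prog`) the linear combination of the normalised WINDOW INCREMENTS is within
`Φ_θ(η_b/b, (2β_u+2b)/√T, 1/J) + 2|θ|β_u/√T` (Fourier distance) of the centred Gaussian with variance `σ²(G)·Σᵢcᵢ²(Kᵢ₊₁ − Kᵢ)/J` — the
covariance of INDEPENDENT Brownian increments `σ·(W(Kᵢ₊₁/J) − W(Kᵢ/J))`.  THEOREMS ONLY, no definition, no sorry; [folklore] (Bhattacharya 1982,
functional CLT for ergodic Markov processes — finite-dimensional part).  HONEST FRAMING: fixed cut-off; `β_u, K` depend on `L, β'`;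
`UniformColdStartMixing` (24809) is NOT restated; no crux, rung or summit statement is proved; the Yang–Mills mass gap is NOT proved.
-/

set_option autoImplicit false

noncomputable section

namespace Summit.QuantumFields.YangMills.Theorems.ColdStartUniversality

open MeasureTheory ProbabilityTheory Filter Topology Set
open scoped NNReal ENNReal BigOperators
open Literature Literature.Probability.Process Literature.MathematicalPhysics.QuantumFieldTheory
open Literature.MathematicalPhysics.QuantumLattice (fundamentalRep fundamentalLatticeRep continuous_fundamentalRep)

variable {L : ℕ} [NeZero L]

/-- Window-indicator sums: `Σ_(k<J) 1[a ≤ k < c]·f k = Σ_(k ∈ [a,c)) f k` for `c ≤ J`. [folklore] -/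
theorem sum_range_ite_window_mul (f : ℕ → ℝ) {J a c : ℕ} (hc : c ≤ J) :
    ∑ k ∈ Finset.range J, (if a ≤ k ∧ k < c then (1 : ℝ) else 0) * f k = ∑ k ∈ Finset.Ico a c, f k := by
  rw [← Finset.sum_filter_add_sum_filter_not (Finset.range J) (fun k => a ≤ k ∧ k < c)]
  have h1 : (Finset.range J).filter (fun k => a ≤ k ∧ k < c) = Finset.Ico a c := by
    ext k; simp [Finset.mem_Ico]; omega
  rw [h1]
  have h2 : ∑ x ∈ (Finset.range J).filter (fun k => ¬(a ≤ k ∧ k < c)), (if a ≤ x ∧ x < c then (1 : ℝ) else 0) * f x = 0 :=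
    Finset.sum_eq_zero fun k hk => by
      rw [Finset.mem_filter] at hk
      rw [if_neg hk.2, zero_mul]
  rw [h2, add_zero]
  exact Finset.sum_congr rfl fun k hk => by
    rw [Finset.mem_Ico] at hk
    rw [if_pos hk, one_mul]

/-- ★★ **Joint CLT estimate for block-aligned window increments** (see the module docstring). [folklore] -/
theorem norm_charFun_windowIncrements_sub_gaussian_le_of_prog (L : ℕ) [NeZero L] (β' : ℝ) :
    ∃ βu K : ℝ, 0 ≤ βu ∧ 0 ≤ K ∧
      ∀ (κ : ℝ≥0 → Kernel (GaugeConfig 3 L (Matrix.specialUnitaryGroup (Fin 2) ℂ))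
          (GaugeConfig 3 L (Matrix.specialUnitaryGroup (Fin 2) ℂ))) [∀ t, IsMarkovKernel (κ t)],
        (∀ (t : ℝ≥0) (x : GaugeConfig 3 L (Matrix.specialUnitaryGroup (Fin 2) ℂ))
          (Ω : Type) [MeasurableSpace Ω] (P : Measure Ω) [IsProbabilityMeasure P]
          (W : ℝ≥0 → Ω → (Edge 3 L × NoiseIdx 2 → ℝ)) (hW : IsFlatBrownian W P)
          (U : ℝ≥0 → Ω → GaugeConfig 3 L (Matrix.specialUnitaryGroup (Fin 2) ℂ)),
          (∀ ω, U 0 ω = x) →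
          (latticeLangevinDynamics (fundamentalLatticeRep 2) β').IsSolution (fundamentalRep (Fin 2))
            hW.natFiltration P W U →
          κ t x = P.map (U t)) →
        ∀ (x : GaugeConfig 3 L (Matrix.specialUnitaryGroup (Fin 2) ℂ))
          (Ω : Type) [MeasurableSpace Ω] (P : Measure Ω) [IsProbabilityMeasure P]
          (W : ℝ≥0 → Ω → (Edge 3 L × NoiseIdx 2 → ℝ)) (hW : IsFlatBrownian W P)
          (U : ℝ≥0 → Ω → GaugeConfig 3 L (Matrix.specialUnitaryGroup (Fin 2) ℂ)),
          (∀ ω, U 0 ω = x) →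
          (latticeLangevinDynamics (fundamentalLatticeRep 2) β').IsSolution (fundamentalRep (Fin 2)) hW.natFiltration P W U →
          (∀ i : ℝ≥0, Measurable[@Prod.instMeasurableSpace (Set.Iic i) Ω inferInstance (hW.natFiltration i)]
            (fun q : Set.Iic i × Ω => U q.1 q.2)) →
        ∀ (G : GaugeConfig 3 L (Matrix.specialUnitaryGroup (Fin 2) ℂ) → ℝ), Continuous G → (∀ z, |G z| ≤ 1) →
        ∀ (σ2 : ℝ), σ2 = 2 * ∫ t in Ioi (0 : ℝ),
            (∫ y, (G y - ∫ z, G z ∂(wilsonMeasure (d := 3) (L := L) (fundamentalRep (Fin 2)) β')) *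
              (∫ z, (G z - ∫ z', G z' ∂(wilsonMeasure (d := 3) (L := L) (fundamentalRep (Fin 2)) β')) ∂(κ t.toNNReal y))
              ∂(wilsonMeasure (d := 3) (L := L) (fundamentalRep (Fin 2)) β')) →
        ∀ (b : ℝ), 0 < b → ∀ (J : ℕ), 1 ≤ J → ∀ (m : ℕ) (Kw : ℕ → ℕ), Monotone Kw → Kw 0 = 0 → Kw m ≤ J →
        ∀ (c : ℕ → ℝ), ∑ i ∈ Finset.range m, |c i| ≤ 1 → ∀ (θ : ℝ),
          0 ≤ σ2 ∧
          ‖(∫ ω, Complex.exp (((θ * ((Real.sqrt (J * b))⁻¹ * ∑ i ∈ Finset.range m, c i *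
              ∫ r in Ioc ((Kw i : ℝ) * b) ((Kw (i + 1) : ℝ) * b), (G (U r.toNNReal ω) - ∫ z, G z ∂(wilsonMeasure (d := 3) (L := L) (fundamentalRep (Fin 2)) β'))) : ℝ) : ℂ) *
              Complex.I) ∂P) -
              Complex.exp (-((θ ^ 2 * (σ2 * (∑ i ∈ Finset.range m, c i ^ 2 * ((Kw (i + 1) : ℝ) - Kw i)) / J) / 2 : ℝ) : ℂ))‖ ≤
            Real.exp (θ ^ 2 * σ2 / 2) *
              (θ ^ 2 * ((K + 2 * βu * ((b * σ2 + K) / Real.sqrt (1 + b) + Real.sqrt (1 + b)) + 4 * βu ^ 2) / b) +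
                |θ| ^ 3 * Real.exp (|θ| * ((2 * βu + 2 * b) / Real.sqrt (J * b))) * ((2 * βu + 2 * b) / Real.sqrt (J * b)) *
                  (σ2 + (K + 2 * βu * ((b * σ2 + K) / Real.sqrt (1 + b) + Real.sqrt (1 + b)) + 4 * βu ^ 2) / b) +
                θ ^ 4 * σ2 ^ 2 / 4 * (J : ℝ)⁻¹ +
                (|θ| * ((2 * βu + 2 * b) / Real.sqrt (J * b)) + θ ^ 2 * ((2 * βu + 2 * b) / Real.sqrt (J * b)) ^ 2 / 2) * (θ ^ 2 * σ2 / 2)) +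
            |θ| * (2 * βu) * (Real.sqrt (J * b))⁻¹ := by
  classical
  haveI := secondCountableTopology_su2
  haveI := borelSpace_config L
  obtain ⟨βu, K, hβ0, hK, hmain⟩ := norm_charFun_weightedBlocks_sub_gaussian_le_of_prog L β'
  refine ⟨βu, K, hβ0, hK, fun κ _ hreal x Ω _ P _ W hW U hU0 hU hprog G hGc hG1 σ2 hσ2 b hb J hJ m Kw hKmono hK0 hKJ c hc θ => ?_⟩
  obtain ⟨u, D, hub, hDm, htel, hσ0, hbound⟩ := hmain κ hreal x Ω P W hW U hU0 hU hprog G hGc hG1 σ2 hσ2 b hb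
  set μ : Measure (GaugeConfig 3 L (Matrix.specialUnitaryGroup (Fin 2) ℂ)) :=
    wilsonMeasure (d := 3) (L := L) (fundamentalRep (Fin 2)) β' with hμ
  set mG : ℝ := ∫ z, G z ∂μ with hmG
  set Gh : GaugeConfig 3 L (Matrix.specialUnitaryGroup (Fin 2) ℂ) → ℝ := fun z => G z - mG with hGh
  have hGhm : Measurable Gh := hGc.measurable.sub measurable_const
  have hmG1 : |mG| ≤ 1 := by
    haveI : IsProbabilityMeasure μ :=
      isProbabilityMeasure_wilsonMeasure (d := 3) (L := L) (fundamentalRep (Fin 2)) (continuous_fundamentalRep (Fin 2)) β'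
    have hh := norm_integral_le_of_norm_le_const (μ := μ) (f := G) (C := 1)
      (Eventually.of_forall fun z => by simpa [Real.norm_eq_abs] using hG1 z)
    simpa [Real.norm_eq_abs] using hh
  have hGhb : ∀ z, |Gh z| ≤ 2 := fun z => (abs_sub _ _).trans (by linarith [hG1 z, hmG1])
  set T : ℝ := J * b with hT
  have hJr : (1 : ℝ) ≤ J := by exact_mod_cast hJ
  have hT0 : 0 < T := by positivity
  set t : ℝ := (Real.sqrt (J * b))⁻¹ with ht
  have ht0 : 0 < t := inv_pos.2 (Real.sqrt_pos.2 hT0)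
  -- paths of the progressively measurable solution
  have hpathm : Measurable fun q : Ω × ℝ => U q.2.toNNReal q.1 :=
    measurable_uncurry_of_prog (Z := U) (fun n : ℕ => hW.natFiltration n) (fun n => hW.natFiltration.le n) (fun n => hprog n)
  have hpath : ∀ ω (y : ℝ), IntegrableOn (fun r : ℝ => Gh (U r.toNNReal ω)) (Ioc (0 : ℝ) y) volume := fun ω y =>
    (integrableOn_const (C := (2 : ℝ)) (hs := measure_Ioc_lt_top.ne)).mono'
      ((hGhm.comp (hpathm.comp (measurable_const.prodMk measurable_id))).aestronglyMeasurable)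
      (Eventually.of_forall fun r => by rw [Real.norm_eq_abs]; exact hGhb _)
  -- `F ω y = ∫_(0,y] Ĝ(U_r ω) dr`, window integrals as differences
  set F : Ω → ℝ → ℝ := fun ω y => ∫ r in Ioc (0 : ℝ) y, Gh (U r.toNNReal ω) with hF
  have hFdiff : ∀ ω (a e : ℝ), 0 ≤ a → a ≤ e → ∫ r in Ioc a e, Gh (U r.toNNReal ω) = F ω e - F ω a := fun ω a e ha hae => by
    simp only [hF]
    rw [← Ioc_union_Ioc_eq_Ioc ha hae, setIntegral_union (Ioc_disjoint_Ioc_of_le le_rfl) measurableSet_Ioc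
      ((hpath ω e).mono_set (Ioc_subset_Ioc_right hae)) ((hpath ω e).mono_set (Ioc_subset_Ioc_left ha))]
    ring
  /- ### 1. The weights and the weighted sum -/
  set w : ℕ → ℝ := fun k => ∑ i ∈ Finset.range m, c i * (if Kw i ≤ k ∧ k < Kw (i + 1) then (1 : ℝ) else 0) with hw
  have hwb : ∀ k, |w k| ≤ 1 := fun k => by
    simp only [hw]
    calc |∑ i ∈ Finset.range m, c i * (if Kw i ≤ k ∧ k < Kw (i + 1) then (1 : ℝ) else 0)|
        ≤ ∑ i ∈ Finset.range m, |c i * (if Kw i ≤ k ∧ k < Kw (i + 1) then (1 : ℝ) else 0)| := Finset.abs_sum_le_sum_abs _ _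
      _ ≤ ∑ i ∈ Finset.range m, |c i| := Finset.sum_le_sum fun i _ => by
          rw [abs_mul]
          have : |(if Kw i ≤ k ∧ k < Kw (i + 1) then (1 : ℝ) else 0)| ≤ 1 := by split_ifs <;> simp
          calc |c i| * |(if Kw i ≤ k ∧ k < Kw (i + 1) then (1 : ℝ) else 0)| ≤ |c i| * 1 := mul_le_mul_of_nonneg_left this (abs_nonneg _)
            _ = |c i| := mul_one _
      _ ≤ 1 := hc
  have hKle : ∀ i, i < m → Kw (i + 1) ≤ J := fun i hi => (hKmono (Nat.succ_le_of_lt hi)).trans hKJ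
  -- `Σ_k w_k D_k = Σ_i c_i (S_{K_{i+1}} − S_{K_i})`
  have hsumD : ∀ ω, ∑ k ∈ Finset.range J, w k * D k ω =
      ∑ i ∈ Finset.range m, c i * ((∫ r in Ioc ((Kw i : ℝ) * b) ((Kw (i + 1) : ℝ) * b), Gh (U r.toNNReal ω)) +
        (u (U (((Kw (i + 1) : ℝ) * b).toNNReal) ω) - u (U (((Kw i : ℝ) * b).toNNReal) ω))) := by
    intro ω
    have h1 : ∑ k ∈ Finset.range J, w k * D k ω =
        ∑ i ∈ Finset.range m, c i * ∑ k ∈ Finset.range J, (if Kw i ≤ k ∧ k < Kw (i + 1) then (1 : ℝ) else 0) * D k ω := by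
      simp only [hw, Finset.sum_mul, Finset.mul_sum]
      rw [Finset.sum_comm]
      exact Finset.sum_congr rfl fun i _ => Finset.sum_congr rfl fun k _ => by ring
    rw [h1]
    refine Finset.sum_congr rfl fun i hi => ?_
    have him : i < m := Finset.mem_range.1 hi
    rw [sum_range_ite_window_mul _ (hKle i him), Finset.sum_Ico_eq_sub _ (hKmono (Nat.le_succ i)), htel, htel]
    have hK0' : (0 : ℝ) ≤ (Kw i : ℝ) * b := by positivity
    have hKK : (Kw i : ℝ) * b ≤ (Kw (i + 1) : ℝ) * b := mul_le_mul_of_nonneg_right (by exact_mod_cast hKmono (Nat.le_succ i)) hb.le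
    rw [hFdiff ω _ _ hK0' hKK]
    simp only [hF]
    ring
  -- `Σ_k w_k² = Σ_i c_i² (K_{i+1} − K_i)`
  have hwsq : ∀ k, w k ^ 2 = ∑ i ∈ Finset.range m, c i ^ 2 * (if Kw i ≤ k ∧ k < Kw (i + 1) then (1 : ℝ) else 0) := by
    intro k
    -- at most one window contains `k`
    by_cases hk : ∃ i ∈ Finset.range m, Kw i ≤ k ∧ k < Kw (i + 1)
    · obtain ⟨i₀, hi₀, hk₀⟩ := hk
      have huniq : ∀ i ∈ Finset.range m, i ≠ i₀ → ¬(Kw i ≤ k ∧ k < Kw (i + 1)) := by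
        intro i _ hne hki
        rcases lt_or_gt_of_ne hne with hlt | hlt
        · exact absurd (lt_of_lt_of_le hki.2 ((hKmono (Nat.succ_le_of_lt hlt)).trans hk₀.1)) (lt_irrefl _)
        · exact absurd (lt_of_lt_of_le hk₀.2 ((hKmono (Nat.succ_le_of_lt hlt)).trans hki.1)) (lt_irrefl _)
      have hw0 : w k = c i₀ := by
        simp only [hw]
        rw [Finset.sum_eq_single i₀ (fun i hi hne => by rw [if_neg (huniq i hi hne), mul_zero]) (fun h => absurd hi₀ h), if_pos hk₀, mul_one]
      rw [hw0, Finset.sum_eq_single i₀ (fun i hi hne => by rw [if_neg (huniq i hi hne), mul_zero]) (fun h => absurd hi₀ h), if_pos hk₀, mul_one]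
    · have hk' : ∀ i ∈ Finset.range m, ¬(Kw i ≤ k ∧ k < Kw (i + 1)) := fun i hi hki => hk ⟨i, hi, hki⟩
      have hw0 : w k = 0 := by
        simp only [hw]; exact Finset.sum_eq_zero fun i hi => by rw [if_neg (hk' i hi), mul_zero]
      rw [hw0, Finset.sum_eq_zero fun i hi => by rw [if_neg (hk' i hi), mul_zero]]
      ring
  have hsumw : ∑ k ∈ Finset.range J, w k ^ 2 = ∑ i ∈ Finset.range m, c i ^ 2 * ((Kw (i + 1) : ℝ) - Kw i) := by
    simp_rw [hwsq]
    rw [Finset.sum_comm]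
    refine Finset.sum_congr rfl fun i hi => ?_
    have him : i < m := Finset.mem_range.1 hi
    rw [← Finset.mul_sum]
    congr 1
    have h := sum_range_ite_window_mul (fun _ => (1 : ℝ)) (J := J) (a := Kw i) (c := Kw (i + 1)) (hKle i him)
    simp only [mul_one] at h
    rw [h, Finset.sum_const, Nat.card_Ico, nsmul_eq_mul, mul_one, Nat.cast_sub (hKmono (Nat.le_succ i))]
  /- ### 2. The weighted-block estimate and the corrector perturbation -/
  have hB := hbound J hJ w hwb θ
  rw [hsumw] at hB
  -- statistics
  have hmU : ∀ s : ℝ≥0, Measurable (U s) := fun s => (hU.adapted s).mono (hW.natFiltration.le s) le_rfl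
  have hIm : ∀ a e : ℝ, Measurable fun ω => ∫ r in Ioc a e, Gh (U r.toNNReal ω) := fun a e => by
    have h1 : Measurable (Function.uncurry fun (ω : Ω) (r : ℝ) => Gh (U r.toNNReal ω)) := hGhm.comp hpathm
    exact (h1.stronglyMeasurable.integral_prod_right' (ν := volume.restrict (Ioc a e))).measurable
  have hAm : Measurable fun ω => t * ∑ i ∈ Finset.range m, c i * ∫ r in Ioc ((Kw i : ℝ) * b) ((Kw (i + 1) : ℝ) * b), Gh (U r.toNNReal ω) :=
    (Finset.measurable_sum _ fun i _ => (hIm _ _).const_mul _).const_mul _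
  have hSm : Measurable fun ω => t * ∑ k ∈ Finset.range J, w k * D k ω :=
    (Finset.measurable_sum _ fun k _ => (hDm k).const_mul _).const_mul _
  have hdiff : ∀ ω, |t * (∑ i ∈ Finset.range m, c i * ∫ r in Ioc ((Kw i : ℝ) * b) ((Kw (i + 1) : ℝ) * b), Gh (U r.toNNReal ω)) -
      t * ∑ k ∈ Finset.range J, w k * D k ω| ≤ t * (2 * βu) := by
    intro ω
    rw [hsumD ω, ← mul_sub, ← Finset.sum_sub_distrib, abs_mul, abs_of_pos ht0]
    refine mul_le_mul_of_nonneg_left ?_ ht0.le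
    have hterm : ∀ i ∈ Finset.range m, |c i * (∫ r in Ioc ((Kw i : ℝ) * b) ((Kw (i + 1) : ℝ) * b), Gh (U r.toNNReal ω)) -
        c i * ((∫ r in Ioc ((Kw i : ℝ) * b) ((Kw (i + 1) : ℝ) * b), Gh (U r.toNNReal ω)) +
          (u (U (((Kw (i + 1) : ℝ) * b).toNNReal) ω) - u (U (((Kw i : ℝ) * b).toNNReal) ω)))| ≤ |c i| * (2 * βu) := by
      intro i _
      rw [show c i * (∫ r in Ioc ((Kw i : ℝ) * b) ((Kw (i + 1) : ℝ) * b), Gh (U r.toNNReal ω)) -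
          c i * ((∫ r in Ioc ((Kw i : ℝ) * b) ((Kw (i + 1) : ℝ) * b), Gh (U r.toNNReal ω)) +
            (u (U (((Kw (i + 1) : ℝ) * b).toNNReal) ω) - u (U (((Kw i : ℝ) * b).toNNReal) ω))) =
          -(c i * (u (U (((Kw (i + 1) : ℝ) * b).toNNReal) ω) - u (U (((Kw i : ℝ) * b).toNNReal) ω))) by ring, abs_neg, abs_mul]
      refine mul_le_mul_of_nonneg_left ((abs_sub _ _).trans ?_) (abs_nonneg _)
      linarith [hub (U (((Kw (i + 1) : ℝ) * b).toNNReal) ω), hub (U (((Kw i : ℝ) * b).toNNReal) ω)]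
    calc |∑ i ∈ Finset.range m, (c i * (∫ r in Ioc ((Kw i : ℝ) * b) ((Kw (i + 1) : ℝ) * b), Gh (U r.toNNReal ω)) -
          c i * ((∫ r in Ioc ((Kw i : ℝ) * b) ((Kw (i + 1) : ℝ) * b), Gh (U r.toNNReal ω)) +
            (u (U (((Kw (i + 1) : ℝ) * b).toNNReal) ω) - u (U (((Kw i : ℝ) * b).toNNReal) ω))))|
        ≤ ∑ i ∈ Finset.range m, |c i| * (2 * βu) := (Finset.abs_sum_le_sum_abs _ _).trans (Finset.sum_le_sum hterm)
      _ = (∑ i ∈ Finset.range m, |c i|) * (2 * βu) := by rw [Finset.sum_mul]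
      _ ≤ 1 * (2 * βu) := mul_le_mul_of_nonneg_right hc (by positivity)
      _ = 2 * βu := one_mul _
  have hpert := norm_integral_cexp_sub_integral_cexp_le (P := P) hAm hSm hdiff θ
  refine ⟨hσ0, ?_⟩
  -- assemble with the triangle inequality
  have htri := norm_sub_le_norm_sub_add_norm_sub
    (∫ ω, Complex.exp (((θ * (t * ∑ i ∈ Finset.range m, c i * ∫ r in Ioc ((Kw i : ℝ) * b) ((Kw (i + 1) : ℝ) * b), Gh (U r.toNNReal ω)) : ℝ) : ℂ) * Complex.I) ∂P)
    (∫ ω, Complex.exp (((θ * (t * ∑ k ∈ Finset.range J, w k * D k ω) : ℝ) : ℂ) * Complex.I) ∂P)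
    (Complex.exp (-((θ ^ 2 * (σ2 * (∑ i ∈ Finset.range m, c i ^ 2 * ((Kw (i + 1) : ℝ) - Kw i)) / J) / 2 : ℝ) : ℂ)))
  refine htri.trans ?_
  rw [add_comm]
  refine add_le_add hB ?_
  calc ‖(∫ ω, Complex.exp (((θ * (t * ∑ i ∈ Finset.range m, c i * ∫ r in Ioc ((Kw i : ℝ) * b) ((Kw (i + 1) : ℝ) * b), Gh (U r.toNNReal ω)) : ℝ) : ℂ) * Complex.I) ∂P) -
        ∫ ω, Complex.exp (((θ * (t * ∑ k ∈ Finset.range J, w k * D k ω) : ℝ) : ℂ) * Complex.I) ∂P‖ ≤ |θ| * (t * (2 * βu)) := hpert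
    _ = |θ| * (2 * βu) * t := by ring

end Summit.QuantumFields.YangMills.Theorems.ColdStartUniversality

end
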